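import Summits.QuantumFields.YangMills.Theorems.UnitScaleTiltProp7ConeRegauge
import HarnessLib

/-!
# Route `UnitScaleTilt`, crux K1 «MinimiserStabilityRegPr» (stmt-QuantumFields-19200), route-R E′ path (α′), (E1-b) covariant, (N-cov) near field — «CONE ROWS», FILE D:
# THE CONE FRAME IN THE TRANSPLANT'S BINDER SHAPE — ✓ `Prop7ConeRegauge.exists_coneFrame_of_regPr` (p674872) re-exported as the three POINTWISE row functions
# `h1 ∕ h1' ∕ h2` of ✓ `Prop7TransplantNorms.sum_sqrt_hs_covLaplace_framedConst_le` (ym-routeR-w6 g6, p675919): size at `z`, size at `z − e_μ`, LONGITUDINAL difference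
# `link(z) − link(z − e_μ)`, for every `z` of the ball `tdist(z, x₀) ≤ ρ`, with `t₁ z := (τ₂ + 2τ₁²)·(tdist(z,x₀) + 1)`, `t₂ z := τ₂ + 4τ₁² + 2τ₁τ₂·(tdist(z,x₀) + 2)`

Cell `ym3-torus`, extra width seat `ym-routeR-w4` (g10); offer «CONE-INST» (bus 2026-08-28((((ℓ + 1 : ℕ) : ℝ) ^ (K - n))⁻¹ * ((((ℓ + 1 : ℕ) : ℝ) ^ (K - n))⁻¹ * (c35 * (((ℓ + 1 : ℕ) : ℝ) * (((ℓ + 1) ^ a' : ℕ) : ℝ)) * α₀))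
                      * Real.exp ((((ℓ + 1 : ℕ) : ℝ) ^ (K - n))⁻¹ * (c35 * (((ℓ + 1 : ℕ) : ℝ) * (((ℓ + 1) ^ a' : ℕ) : ℝ)) * α₀)))2:40∕22:56Z) for routeR-w6 g6's gen-0∕gen-1 instantiations («pure plumbing …
with `t₁ z := (τ₂′+2τ₁′²)(tdist z y₀ + 1)`», 22:57:16Z).  The frame is the cone frame of FILE C at radius `r := ρ + 1` (the backward rows at `z` are the forward rows of
FILE C at `z − e_μ`, which lies in the `(ρ+1)`-ball).  THEOREMS ONLY (0 `def`, 0 `sorry`); `--supports stmt-QuantumFields-19200`, count-neutral.  YM₃ on T³ is a ladder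
rung (R3), not the Clay problem; nothing here claims a stub, the crux, d = 4 or the mass gap.

WHAT IS PROVED (ns `…Theorems.Prop7ConeRegaugeInst`).
* `tdist_unshift_le_succ` (`tdist(z − e_μ, x₀) ≤ tdist(z, x₀) + 1`).
* ★★★ `exists_coneFrame_rows_of_regPr` — `∃ c35 a₅ > 0, ∀ member, ∀ α₀ > 0, M·α₀ ≤ a₅ → ∀ W, RegPr → ∀ x₀ ρ, 2(ρ+1) + 4 ≤ bigSide → ∃ Fr′, (∀ z, bi-contractive) ∧ Fr′ x₀ = 1 ∧
  (h1) ∧ (h1') ∧ (h2)` in p675919's literal letters (`U := fun κ z => unitsField (toUField W) ⟨z, κ⟩`, `(torusT P 0 μ).symm z`, `Fr′ (torusT P 0 μ ((torusT P 0 μ).symm z))` kept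
  unsimplified where p675919 keeps it).
HONEST SCOPE.  Plumbing over FILE C; no new analysis.

References: T. Bałaban, CMP 99 (1985) 389–434 [Balaban1985BackgroundPropagators] ((3.28) p.395, (3.35) p.396); CMP 99 (1985) 75–102 [Balaban1985RegularSpaces] ((1.33) p.82, Prop. 6 p.99).
-/

set_option autoImplicit false

noncomputable section

open scoped Matrix.Norms.L2Operator

namespace Summit.QuantumFields.YangMills.Theorems.Prop7ConeRegaugeInst

open Literature.MathematicalPhysics.QuantumFieldTheory.Balaban1983to89
open Literature.MathematicalPhysics.QuantumFieldTheory.Balaban1983to89.T3ContinuumYM3Torus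
open Literature.MathematicalPhysics.QuantumFieldTheory.Balaban1983to89.T3PrintedRegularMinimiser (RegPr)
open Literature.MathematicalPhysics.QuantumFieldTheory.Balaban1983to89.B6GlobalChartV1 (PV)
open B9TorusCalculus (torusT torusT_apply torusT_symm_apply)
open B6MultiLevelBoxOperator (bigSide)
open B10Eq27TorusAxialLog (unitsField toUField)
open B3Taylor310LocalRemainder (tdist_triangle tdist_unshift_le_one)
open Summit.QuantumFields.YangMills.Theorems.Prop7SectET3Members (hd3)
open Summit.QuantumFields.YangMills.Theorems.Prop7ConeRegauge (exists_coneFrame_of_regPr)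

/-- one backward step moves at most one unit away from the pole: `tdist(z − e_μ, x₀) ≤ tdist(z, x₀) + 1`. [folklore] -/
theorem tdist_unshift_le_succ {P : Params} {j : ℕ} (z x₀ : Site P j) (μ : Fin P.d) :
    Site.tdist ((torusT P j μ).symm z) x₀ ≤ Site.tdist z x₀ + 1 := by
  rw [torusT_symm_apply]
  have h := tdist_triangle (z.unshift μ) z x₀
  have h1 := tdist_unshift_le_one z μ
  omega

section Member

variable {ℓ : ℕ} {hL : Odd (ℓ + 1) ∧ 1 < ℓ + 1}

/-- ★★★ **THE CONE FRAME IN THE TRANSPLANT'S BINDER SHAPE** (see the module docstring): the three pointwise row functions `h1 ∕ h1' ∕ h2` of ✓ `Prop7TransplantNorms` §3 on the ball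
`tdist(z, x₀) ≤ ρ`, with `t₁ z = (τ₂ + 2τ₁²)·(tdist(z,x₀) + 1)` and `t₂ z = τ₂ + 4τ₁² + 2τ₁τ₂·(tdist(z,x₀) + 2)`, `τ₁ = ηC′e^{ηC′}`, `τ₂ = η(ηC′)e^{ηC′}`, `η = (L^{K−n})⁻¹`,
`C′ = c35·(L·L^{a′})·α₀`; frame bi-contractive everywhere and `= 1` at the pole. [cite: Balaban1985RegularSpaces, (1.33) p.82, Prop. 6 p.99; Balaban1985BackgroundPropagators, (3.35) p.396, (3.28) p.395] -/
theorem exists_coneFrame_rows_of_regPr (hℓ4 : 4 ≤ ℓ) :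
    ∃ c35 a₅ : ℝ, 0 < c35 ∧ 0 < a₅ ∧
      ∀ (hℓ : 4 ≤ ℓ) (m : ℕ) (hm : 1 ≤ m) (n K a' R : ℕ) (hk1 : 1 ≤ K - n) (hsize : a' + 3 ≤ m + n) (hM8 : 8 ≤ (ℓ + 1) ^ a')
        (hR2 : 2 * (ℓ + 1) ^ 2 ≤ R) (α₀ : ℝ), 0 < α₀ → ((ℓ + 1 : ℕ) : ℝ) * (((ℓ + 1) ^ a' : ℕ) : ℝ) * α₀ ≤ a₅ →
        ∀ W : GaugeField (PV 2 ℓ m K hd3 hL) 0 (Matrix.specialUnitaryGroup (Fin 2) ℂ),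
          RegPr (⟨ℓ + 1, hL, m, hm⟩ : T3Family) n K α₀ W →
          ∀ (x₀ : Site (PV 2 ℓ m K hd3 hL) 0) (ρ : ℕ), 2 * (ρ + 1) + 4 ≤ bigSide ℓ ((ℓ + 1) ^ a') (K - n) →
            ∃ Fr : Site (PV 2 ℓ m K hd3 hL) 0 → (Matrix (Fin 2) (Fin 2) ℂ)ˣ,
              (∀ z : Site (PV 2 ℓ m K hd3 hL) 0, ‖(Fr z : Matrix (Fin 2) (Fin 2) ℂ)‖ ≤ 1 ∧ ‖(((Fr z)⁻¹ : (Matrix (Fin 2) (Fin 2) ℂ)ˣ) : Matrix (Fin 2) (Fin 2) ℂ)‖ ≤ 1) ∧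
              Fr x₀ = 1 ∧
              (∀ z : Site (PV 2 ℓ m K hd3 hL) 0, Site.tdist z x₀ ≤ ρ → ∀ μ : Fin (PV 2 ℓ m K hd3 hL).d,
                ‖(((Fr z)⁻¹ * unitsField (toUField W) ⟨z, μ⟩ * Fr (torusT (PV 2 ℓ m K hd3 hL) 0 μ z) : (Matrix (Fin 2) (Fin 2) ℂ)ˣ) : Matrix (Fin 2) (Fin 2) ℂ) - 1‖
                  ≤ (((((ℓ + 1 : ℕ) : ℝ) ^ (K - n))⁻¹ * ((((ℓ + 1 : ℕ) : ℝ) ^ (K - n))⁻¹ * (c35 * (((ℓ + 1 : ℕ) : ℝ) * (((ℓ + 1) ^ a' : ℕ) : ℝ)) * α₀))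
                      * Real.exp ((((ℓ + 1 : ℕ) : ℝ) ^ (K - n))⁻¹ * (c35 * (((ℓ + 1 : ℕ) : ℝ) * (((ℓ + 1) ^ a' : ℕ) : ℝ)) * α₀))) + 2 * ((((ℓ + 1 : ℕ) : ℝ) ^ (K - n))⁻¹ * (c35 * (((ℓ + 1 : ℕ) : ℝ) * (((ℓ + 1) ^ a' : ℕ) : ℝ)) * α₀)
                      * Real.exp ((((ℓ + 1 : ℕ) : ℝ) ^ (K - n))⁻¹ * (c35 * (((ℓ + 1 : ℕ) : ℝ) * (((ℓ + 1) ^ a' : ℕ) : ℝ)) * α₀))) ^ 2) * ((Site.tdist z x₀ : ℝ) + 1)) ∧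
              (∀ z : Site (PV 2 ℓ m K hd3 hL) 0, Site.tdist z x₀ ≤ ρ → ∀ μ : Fin (PV 2 ℓ m K hd3 hL).d,
                ‖(((Fr ((torusT (PV 2 ℓ m K hd3 hL) 0 μ).symm z))⁻¹ * unitsField (toUField W) ⟨(torusT (PV 2 ℓ m K hd3 hL) 0 μ).symm z, μ⟩
                      * Fr (torusT (PV 2 ℓ m K hd3 hL) 0 μ ((torusT (PV 2 ℓ m K hd3 hL) 0 μ).symm z)) : (Matrix (Fin 2) (Fin 2) ℂ)ˣ) : Matrix (Fin 2) (Fin 2) ℂ) - 1‖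
                  ≤ (((((ℓ + 1 : ℕ) : ℝ) ^ (K - n))⁻¹ * ((((ℓ + 1 : ℕ) : ℝ) ^ (K - n))⁻¹ * (c35 * (((ℓ + 1 : ℕ) : ℝ) * (((ℓ + 1) ^ a' : ℕ) : ℝ)) * α₀))
                      * Real.exp ((((ℓ + 1 : ℕ) : ℝ) ^ (K - n))⁻¹ * (c35 * (((ℓ + 1 : ℕ) : ℝ) * (((ℓ + 1) ^ a' : ℕ) : ℝ)) * α₀))) + 2 * ((((ℓ + 1 : ℕ) : ℝ) ^ (K - n))⁻¹ * (c35 * (((ℓ + 1 : ℕ) : ℝ) * (((ℓ + 1) ^ a' : ℕ) : ℝ)) * α₀)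
                      * Real.exp ((((ℓ + 1 : ℕ) : ℝ) ^ (K - n))⁻¹ * (c35 * (((ℓ + 1 : ℕ) : ℝ) * (((ℓ + 1) ^ a' : ℕ) : ℝ)) * α₀))) ^ 2) * ((Site.tdist z x₀ : ℝ) + 1)) ∧
              (∀ z : Site (PV 2 ℓ m K hd3 hL) 0, Site.tdist z x₀ ≤ ρ → ∀ μ : Fin (PV 2 ℓ m K hd3 hL).d,
                ‖(((Fr z)⁻¹ * unitsField (toUField W) ⟨z, μ⟩ * Fr (torusT (PV 2 ℓ m K hd3 hL) 0 μ z) : (Matrix (Fin 2) (Fin 2) ℂ)ˣ) : Matrix (Fin 2) (Fin 2) ℂ)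
                    - (((Fr ((torusT (PV 2 ℓ m K hd3 hL) 0 μ).symm z))⁻¹ * unitsField (toUField W) ⟨(torusT (PV 2 ℓ m K hd3 hL) 0 μ).symm z, μ⟩
                      * Fr (torusT (PV 2 ℓ m K hd3 hL) 0 μ ((torusT (PV 2 ℓ m K hd3 hL) 0 μ).symm z)) : (Matrix (Fin 2) (Fin 2) ℂ)ˣ) : Matrix (Fin 2) (Fin 2) ℂ)‖
                  ≤ ((((ℓ + 1 : ℕ) : ℝ) ^ (K - n))⁻¹ * ((((ℓ + 1 : ℕ) : ℝ) ^ (K - n))⁻¹ * (c35 * (((ℓ + 1 : ℕ) : ℝ) * (((ℓ + 1) ^ a' : ℕ) : ℝ)) * α₀))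
                      * Real.exp ((((ℓ + 1 : ℕ) : ℝ) ^ (K - n))⁻¹ * (c35 * (((ℓ + 1 : ℕ) : ℝ) * (((ℓ + 1) ^ a' : ℕ) : ℝ)) * α₀))) + 4 * ((((ℓ + 1 : ℕ) : ℝ) ^ (K - n))⁻¹ * (c35 * (((ℓ + 1 : ℕ) : ℝ) * (((ℓ + 1) ^ a' : ℕ) : ℝ)) * α₀)
                      * Real.exp ((((ℓ + 1 : ℕ) : ℝ) ^ (K - n))⁻¹ * (c35 * (((ℓ + 1 : ℕ) : ℝ) * (((ℓ + 1) ^ a' : ℕ) : ℝ)) * α₀))) ^ 2 + 2 * ((((ℓ + 1 : ℕ) : ℝ) ^ (K - n))⁻¹ * (c35 * (((ℓ + 1 : ℕ) : ℝ) * (((ℓ + 1) ^ a' : ℕ) : ℝ)) * α₀)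
                      * Real.exp ((((ℓ + 1 : ℕ) : ℝ) ^ (K - n))⁻¹ * (c35 * (((ℓ + 1 : ℕ) : ℝ) * (((ℓ + 1) ^ a' : ℕ) : ℝ)) * α₀))) * ((((ℓ + 1 : ℕ) : ℝ) ^ (K - n))⁻¹ * ((((ℓ + 1 : ℕ) : ℝ) ^ (K - n))⁻¹ * (c35 * (((ℓ + 1 : ℕ) : ℝ) * (((ℓ + 1) ^ a' : ℕ) : ℝ)) * α₀))
                      * Real.exp ((((ℓ + 1 : ℕ) : ℝ) ^ (K - n))⁻¹ * (c35 * (((ℓ + 1 : ℕ) : ℝ) * (((ℓ + 1) ^ a' : ℕ) : ℝ)) * α₀))) * ((Site.tdist z x₀ : ℝ) + 2)) := by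
  obtain ⟨c35, a₅, hc35, ha₅, H⟩ := exists_coneFrame_of_regPr (hL := hL) hℓ4
  refine ⟨c35, a₅, hc35, ha₅, ?_⟩
  intro hℓ m hm n K a' R hk1 hsize hM8 hR2 α₀ hα₀ hMα W hreg x₀ ρ hρ
  obtain ⟨Fr, hFr, hFr1, hsize', hdiff⟩ := H hℓ m hm n K a' R hk1 hsize hM8 hR2 α₀ hα₀ hMα W hreg x₀ (ρ + 1) hρ
  have hτ₁ : 0 ≤ ((((ℓ + 1 : ℕ) : ℝ) ^ (K - n))⁻¹ * (c35 * (((ℓ + 1 : ℕ) : ℝ) * (((ℓ + 1) ^ a' : ℕ) : ℝ)) * α₀)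
                      * Real.exp ((((ℓ + 1 : ℕ) : ℝ) ^ (K - n))⁻¹ * (c35 * (((ℓ + 1 : ℕ) : ℝ) * (((ℓ + 1) ^ a' : ℕ) : ℝ)) * α₀))) := by positivity
  have hτ₂ : 0 ≤ ((((ℓ + 1 : ℕ) : ℝ) ^ (K - n))⁻¹ * ((((ℓ + 1 : ℕ) : ℝ) ^ (K - n))⁻¹ * (c35 * (((ℓ + 1 : ℕ) : ℝ) * (((ℓ + 1) ^ a' : ℕ) : ℝ)) * α₀))
                      * Real.exp ((((ℓ + 1 : ℕ) : ℝ) ^ (K - n))⁻¹ * (c35 * (((ℓ + 1 : ℕ) : ℝ) * (((ℓ + 1) ^ a' : ℕ) : ℝ)) * α₀))) := by positivity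
  have hc : 0 ≤ ((((ℓ + 1 : ℕ) : ℝ) ^ (K - n))⁻¹ * ((((ℓ + 1 : ℕ) : ℝ) ^ (K - n))⁻¹ * (c35 * (((ℓ + 1 : ℕ) : ℝ) * (((ℓ + 1) ^ a' : ℕ) : ℝ)) * α₀))
                      * Real.exp ((((ℓ + 1 : ℕ) : ℝ) ^ (K - n))⁻¹ * (c35 * (((ℓ + 1 : ℕ) : ℝ) * (((ℓ + 1) ^ a' : ℕ) : ℝ)) * α₀))) + 2 * ((((ℓ + 1 : ℕ) : ℝ) ^ (K - n))⁻¹ * (c35 * (((ℓ + 1 : ℕ) : ℝ) * (((ℓ + 1) ^ a' : ℕ) : ℝ)) * α₀)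
                      * Real.exp ((((ℓ + 1 : ℕ) : ℝ) ^ (K - n))⁻¹ * (c35 * (((ℓ + 1 : ℕ) : ℝ) * (((ℓ + 1) ^ a' : ℕ) : ℝ)) * α₀))) ^ 2 := by positivity
  refine ⟨Fr, hFr, hFr1, fun z hz μ => ?_, fun z hz μ => ?_, fun z hz μ => ?_⟩
  · -- size at `z`: FILE C at `z` (radius `ρ + 1`), then `tdist ≤ tdist + 1`
    refine (hsize' μ z (by omega)).trans ?_
    exact mul_le_mul_of_nonneg_left (by linarith) hc
  · -- size at `z − e_μ`: FILE C at `x := (torusT μ).symm z`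
    have hz' : Site.tdist ((torusT (PV 2 ℓ m K hd3 hL) 0 μ).symm z) x₀ ≤ ρ + 1 := (tdist_unshift_le_succ z x₀ μ).trans (by omega)
    refine (hsize' μ ((torusT (PV 2 ℓ m K hd3 hL) 0 μ).symm z) hz').trans ?_
    refine mul_le_mul_of_nonneg_left ?_ hc
    exact_mod_cast tdist_unshift_le_succ z x₀ μ
  · -- longitudinal difference at `z`: the FORWARD row of FILE C at `x := (torusT μ).symm z`, `ν := μ`
    have hz' : Site.tdist ((torusT (PV 2 ℓ m K hd3 hL) 0 μ).symm z) x₀ ≤ ρ + 1 := (tdist_unshift_le_succ z x₀ μ).trans (by omega)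
    have hrow := hdiff μ μ ((torusT (PV 2 ℓ m K hd3 hL) 0 μ).symm z) hz'
    have e : torusT (PV 2 ℓ m K hd3 hL) 0 μ ((torusT (PV 2 ℓ m K hd3 hL) 0 μ).symm z) = z := Equiv.apply_symm_apply _ _
    rw [e] at hrow ⊢
    refine hrow.trans ?_
    have ht : (Site.tdist ((torusT (PV 2 ℓ m K hd3 hL) 0 μ).symm z) x₀ : ℝ) + 1 ≤ (Site.tdist z x₀ : ℝ) + 2 := by
      have := tdist_unshift_le_succ z x₀ μ
      have : (Site.tdist ((torusT (PV 2 ℓ m K hd3 hL) 0 μ).symm z) x₀ : ℝ) ≤ (Site.tdist z x₀ : ℝ) + 1 := by exact_mod_cast this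
      linarith
    have := mul_le_mul_of_nonneg_left ht (mul_nonneg (mul_nonneg (by norm_num : (0 : ℝ) ≤ 2) hτ₁) hτ₂)
    linarith

/-! ## v1.1 (ym-routeR-w4 g11, «CONE-INST-ANCHORED») — the same rows AND the pole anchor for ONE frame

The (A-cov) transplant assembly ✓ `Prop7CovKernelTransplantAssembly.htr_body_of_rows` (px22 g3, p680070) takes `(hFr1 : Fr b = 1)` and the ANCHOR
`(hpole : Fr (torusT P i μ₀ b) = (U μ₀ b)⁻¹)`, while its numbers (✓ `…TransplantGen0Numbers`, ✓ `…TransplantNearDatum`) are computed under the rows `h1 ∕ h1' ∕ h2`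
of the SAME frame.  FILE C's frame (✓ `exists_coneFrame_of_regPr`) has the SHARP size row `≤ (τ₂+2τ₁²)·tdist(x,x₀)`, which vanishes at the pole and gives the anchor in
every direction; the theorem above re-exported the rows for a fresh existential frame only.  Below: rows + anchor for one frame. -/

/-- ★★★ **THE CONE FRAME IN THE TRANSPLANT'S BINDER SHAPE, ANCHORED AT THE POLE**: the statement of `exists_coneFrame_rows_of_regPr` for ONE frame `Fr` together with the
pole anchor `Fr (T_μ x₀) = (U_μ x₀)⁻¹` in EVERY direction `μ` (FILE C's sharp cone size row reads `≤ (τ₂+2τ₁²)·tdist(x₀,x₀) = 0` at the pole, so the framed link there is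
exactly `1`, and `Fr x₀ = 1`).  This is the `(hFr1) (hpole)` pair of ✓ `Prop7CovKernelTransplantAssembly.htr_body_of_rows` and the `h1 ∕ h1' ∕ h2` rows of
✓ `Prop7TransplantGen0Numbers.exists_gen0_numbers` ∕ ✓ `Prop7TransplantNearDatum.exists_nearDatum_numbers` for the same frame, at every `RegPr` member, pole `x₀` and
radius `ρ` with `2(ρ+1) + 4 ≤ bigSide`. [cite: Balaban1985RegularSpaces, (1.33) p.82, Prop. 6 p.99; Balaban1985BackgroundPropagators, (3.28) p.395, (3.35) p.396] -/
theorem exists_coneFrame_rows_anchored_of_regPr (hℓ4 : 4 ≤ ℓ) :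
    ∃ c35 a₅ : ℝ, 0 < c35 ∧ 0 < a₅ ∧
      ∀ (hℓ : 4 ≤ ℓ) (m : ℕ) (hm : 1 ≤ m) (n K a' R : ℕ) (hk1 : 1 ≤ K - n) (hsize : a' + 3 ≤ m + n) (hM8 : 8 ≤ (ℓ + 1) ^ a')
        (hR2 : 2 * (ℓ + 1) ^ 2 ≤ R) (α₀ : ℝ), 0 < α₀ → ((ℓ + 1 : ℕ) : ℝ) * (((ℓ + 1) ^ a' : ℕ) : ℝ) * α₀ ≤ a₅ →
        ∀ W : GaugeField (PV 2 ℓ m K hd3 hL) 0 (Matrix.specialUnitaryGroup (Fin 2) ℂ),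
          RegPr (⟨ℓ + 1, hL, m, hm⟩ : T3Family) n K α₀ W →
          ∀ (x₀ : Site (PV 2 ℓ m K hd3 hL) 0) (ρ : ℕ), 2 * (ρ + 1) + 4 ≤ bigSide ℓ ((ℓ + 1) ^ a') (K - n) →
            ∃ Fr : Site (PV 2 ℓ m K hd3 hL) 0 → (Matrix (Fin 2) (Fin 2) ℂ)ˣ,
              (∀ z : Site (PV 2 ℓ m K hd3 hL) 0, ‖(Fr z : Matrix (Fin 2) (Fin 2) ℂ)‖ ≤ 1 ∧ ‖(((Fr z)⁻¹ : (Matrix (Fin 2) (Fin 2) ℂ)ˣ) : Matrix (Fin 2) (Fin 2) ℂ)‖ ≤ 1) ∧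
              Fr x₀ = 1 ∧
              (∀ μ : Fin (PV 2 ℓ m K hd3 hL).d, Fr (torusT (PV 2 ℓ m K hd3 hL) 0 μ x₀) = (unitsField (toUField W) ⟨x₀, μ⟩)⁻¹) ∧
              (∀ z : Site (PV 2 ℓ m K hd3 hL) 0, Site.tdist z x₀ ≤ ρ → ∀ μ : Fin (PV 2 ℓ m K hd3 hL).d,
                ‖(((Fr z)⁻¹ * unitsField (toUField W) ⟨z, μ⟩ * Fr (torusT (PV 2 ℓ m K hd3 hL) 0 μ z) : (Matrix (Fin 2) (Fin 2) ℂ)ˣ) : Matrix (Fin 2) (Fin 2) ℂ) - 1‖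
                  ≤ (((((ℓ + 1 : ℕ) : ℝ) ^ (K - n))⁻¹ * ((((ℓ + 1 : ℕ) : ℝ) ^ (K - n))⁻¹ * (c35 * (((ℓ + 1 : ℕ) : ℝ) * (((ℓ + 1) ^ a' : ℕ) : ℝ)) * α₀))
                      * Real.exp ((((ℓ + 1 : ℕ) : ℝ) ^ (K - n))⁻¹ * (c35 * (((ℓ + 1 : ℕ) : ℝ) * (((ℓ + 1) ^ a' : ℕ) : ℝ)) * α₀))) + 2 * ((((ℓ + 1 : ℕ) : ℝ) ^ (K - n))⁻¹ * (c35 * (((ℓ + 1 : ℕ) : ℝ) * (((ℓ + 1) ^ a' : ℕ) : ℝ)) * α₀)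
                      * Real.exp ((((ℓ + 1 : ℕ) : ℝ) ^ (K - n))⁻¹ * (c35 * (((ℓ + 1 : ℕ) : ℝ) * (((ℓ + 1) ^ a' : ℕ) : ℝ)) * α₀))) ^ 2) * ((Site.tdist z x₀ : ℝ) + 1)) ∧
              (∀ z : Site (PV 2 ℓ m K hd3 hL) 0, Site.tdist z x₀ ≤ ρ → ∀ μ : Fin (PV 2 ℓ m K hd3 hL).d,
                ‖(((Fr ((torusT (PV 2 ℓ m K hd3 hL) 0 μ).symm z))⁻¹ * unitsField (toUField W) ⟨(torusT (PV 2 ℓ m K hd3 hL) 0 μ).symm z, μ⟩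
                      * Fr (torusT (PV 2 ℓ m K hd3 hL) 0 μ ((torusT (PV 2 ℓ m K hd3 hL) 0 μ).symm z)) : (Matrix (Fin 2) (Fin 2) ℂ)ˣ) : Matrix (Fin 2) (Fin 2) ℂ) - 1‖
                  ≤ (((((ℓ + 1 : ℕ) : ℝ) ^ (K - n))⁻¹ * ((((ℓ + 1 : ℕ) : ℝ) ^ (K - n))⁻¹ * (c35 * (((ℓ + 1 : ℕ) : ℝ) * (((ℓ + 1) ^ a' : ℕ) : ℝ)) * α₀))
                      * Real.exp ((((ℓ + 1 : ℕ) : ℝ) ^ (K - n))⁻¹ * (c35 * (((ℓ + 1 : ℕ) : ℝ) * (((ℓ + 1) ^ a' : ℕ) : ℝ)) * α₀))) + 2 * ((((ℓ + 1 : ℕ) : ℝ) ^ (K - n))⁻¹ * (c35 * (((ℓ + 1 : ℕ) : ℝ) * (((ℓ + 1) ^ a' : ℕ) : ℝ)) * α₀)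
                      * Real.exp ((((ℓ + 1 : ℕ) : ℝ) ^ (K - n))⁻¹ * (c35 * (((ℓ + 1 : ℕ) : ℝ) * (((ℓ + 1) ^ a' : ℕ) : ℝ)) * α₀))) ^ 2) * ((Site.tdist z x₀ : ℝ) + 1)) ∧
              (∀ z : Site (PV 2 ℓ m K hd3 hL) 0, Site.tdist z x₀ ≤ ρ → ∀ μ : Fin (PV 2 ℓ m K hd3 hL).d,
                ‖(((Fr z)⁻¹ * unitsField (toUField W) ⟨z, μ⟩ * Fr (torusT (PV 2 ℓ m K hd3 hL) 0 μ z) : (Matrix (Fin 2) (Fin 2) ℂ)ˣ) : Matrix (Fin 2) (Fin 2) ℂ)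
                    - (((Fr ((torusT (PV 2 ℓ m K hd3 hL) 0 μ).symm z))⁻¹ * unitsField (toUField W) ⟨(torusT (PV 2 ℓ m K hd3 hL) 0 μ).symm z, μ⟩
                      * Fr (torusT (PV 2 ℓ m K hd3 hL) 0 μ ((torusT (PV 2 ℓ m K hd3 hL) 0 μ).symm z)) : (Matrix (Fin 2) (Fin 2) ℂ)ˣ) : Matrix (Fin 2) (Fin 2) ℂ)‖
                  ≤ ((((ℓ + 1 : ℕ) : ℝ) ^ (K - n))⁻¹ * ((((ℓ + 1 : ℕ) : ℝ) ^ (K - n))⁻¹ * (c35 * (((ℓ + 1 : ℕ) : ℝ) * (((ℓ + 1) ^ a' : ℕ) : ℝ)) * α₀))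
                      * Real.exp ((((ℓ + 1 : ℕ) : ℝ) ^ (K - n))⁻¹ * (c35 * (((ℓ + 1 : ℕ) : ℝ) * (((ℓ + 1) ^ a' : ℕ) : ℝ)) * α₀))) + 4 * ((((ℓ + 1 : ℕ) : ℝ) ^ (K - n))⁻¹ * (c35 * (((ℓ + 1 : ℕ) : ℝ) * (((ℓ + 1) ^ a' : ℕ) : ℝ)) * α₀)
                      * Real.exp ((((ℓ + 1 : ℕ) : ℝ) ^ (K - n))⁻¹ * (c35 * (((ℓ + 1 : ℕ) : ℝ) * (((ℓ + 1) ^ a' : ℕ) : ℝ)) * α₀))) ^ 2 + 2 * ((((ℓ + 1 : ℕ) : ℝ) ^ (K - n))⁻¹ * (c35 * (((ℓ + 1 : ℕ) : ℝ) * (((ℓ + 1) ^ a' : ℕ) : ℝ)) * α₀)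
                      * Real.exp ((((ℓ + 1 : ℕ) : ℝ) ^ (K - n))⁻¹ * (c35 * (((ℓ + 1 : ℕ) : ℝ) * (((ℓ + 1) ^ a' : ℕ) : ℝ)) * α₀))) * ((((ℓ + 1 : ℕ) : ℝ) ^ (K - n))⁻¹ * ((((ℓ + 1 : ℕ) : ℝ) ^ (K - n))⁻¹ * (c35 * (((ℓ + 1 : ℕ) : ℝ) * (((ℓ + 1) ^ a' : ℕ) : ℝ)) * α₀))
                      * Real.exp ((((ℓ + 1 : ℕ) : ℝ) ^ (K - n))⁻¹ * (c35 * (((ℓ + 1 : ℕ) : ℝ) * (((ℓ + 1) ^ a' : ℕ) : ℝ)) * α₀))) * ((Site.tdist z x₀ : ℝ) + 2)) := by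
  obtain ⟨c35, a₅, hc35, ha₅, H⟩ := exists_coneFrame_of_regPr (hL := hL) hℓ4
  refine ⟨c35, a₅, hc35, ha₅, ?_⟩
  intro hℓ m hm n K a' R hk1 hsize hM8 hR2 α₀ hα₀ hMα W hreg x₀ ρ hρ
  obtain ⟨Fr, hFr, hFr1, hsize', hdiff⟩ := H hℓ m hm n K a' R hk1 hsize hM8 hR2 α₀ hα₀ hMα W hreg x₀ (ρ + 1) hρ
  have hτ₁ : 0 ≤ ((((ℓ + 1 : ℕ) : ℝ) ^ (K - n))⁻¹ * (c35 * (((ℓ + 1 : ℕ) : ℝ) * (((ℓ + 1) ^ a' : ℕ) : ℝ)) * α₀)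
                      * Real.exp ((((ℓ + 1 : ℕ) : ℝ) ^ (K - n))⁻¹ * (c35 * (((ℓ + 1 : ℕ) : ℝ) * (((ℓ + 1) ^ a' : ℕ) : ℝ)) * α₀))) := by positivity
  have hτ₂ : 0 ≤ ((((ℓ + 1 : ℕ) : ℝ) ^ (K - n))⁻¹ * ((((ℓ + 1 : ℕ) : ℝ) ^ (K - n))⁻¹ * (c35 * (((ℓ + 1 : ℕ) : ℝ) * (((ℓ + 1) ^ a' : ℕ) : ℝ)) * α₀))
                      * Real.exp ((((ℓ + 1 : ℕ) : ℝ) ^ (K - n))⁻¹ * (c35 * (((ℓ + 1 : ℕ) : ℝ) * (((ℓ + 1) ^ a' : ℕ) : ℝ)) * α₀))) := by positivity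
  have hc : 0 ≤ ((((ℓ + 1 : ℕ) : ℝ) ^ (K - n))⁻¹ * ((((ℓ + 1 : ℕ) : ℝ) ^ (K - n))⁻¹ * (c35 * (((ℓ + 1 : ℕ) : ℝ) * (((ℓ + 1) ^ a' : ℕ) : ℝ)) * α₀))
                      * Real.exp ((((ℓ + 1 : ℕ) : ℝ) ^ (K - n))⁻¹ * (c35 * (((ℓ + 1 : ℕ) : ℝ) * (((ℓ + 1) ^ a' : ℕ) : ℝ)) * α₀))) + 2 * ((((ℓ + 1 : ℕ) : ℝ) ^ (K - n))⁻¹ * (c35 * (((ℓ + 1 : ℕ) : ℝ) * (((ℓ + 1) ^ a' : ℕ) : ℝ)) * α₀)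
                      * Real.exp ((((ℓ + 1 : ℕ) : ℝ) ^ (K - n))⁻¹ * (c35 * (((ℓ + 1 : ℕ) : ℝ) * (((ℓ + 1) ^ a' : ℕ) : ℝ)) * α₀))) ^ 2 := by positivity
  -- the ANCHOR: FILE C's sharp size row at the pole is `≤ (…)·tdist(x₀,x₀) = 0`, so the framed link there is `1`; with `Fr x₀ = 1` this pins `Fr (T_μ x₀) = (U_μ x₀)⁻¹`
  have hpole : ∀ μ : Fin (PV 2 ℓ m K hd3 hL).d, Fr (torusT (PV 2 ℓ m K hd3 hL) 0 μ x₀) = (unitsField (toUField W) ⟨x₀, μ⟩)⁻¹ := by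
    intro μ
    have h0 := hsize' μ x₀ (by rw [B3Taylor310LocalRemainder.tdist_self]; exact Nat.zero_le _)
    rw [B3Taylor310LocalRemainder.tdist_self, Nat.cast_zero, mul_zero] at h0
    have h1 : (((Fr x₀)⁻¹ * unitsField (toUField W) ⟨x₀, μ⟩ * Fr (torusT (PV 2 ℓ m K hd3 hL) 0 μ x₀) : (Matrix (Fin 2) (Fin 2) ℂ)ˣ) : Matrix (Fin 2) (Fin 2) ℂ) = 1 :=
      sub_eq_zero.1 (norm_le_zero_iff.1 h0)
    have h2 : (Fr x₀)⁻¹ * unitsField (toUField W) ⟨x₀, μ⟩ * Fr (torusT (PV 2 ℓ m K hd3 hL) 0 μ x₀) = 1 := Units.ext (by rw [Units.val_one]; exact h1)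
    rw [hFr1, inv_one, one_mul] at h2
    exact eq_inv_of_mul_eq_one_right h2
  refine ⟨Fr, hFr, hFr1, hpole, fun z hz μ => ?_, fun z hz μ => ?_, fun z hz μ => ?_⟩
  · -- size at `z`: FILE C at `z` (radius `ρ + 1`), then `tdist ≤ tdist + 1`
    refine (hsize' μ z (by omega)).trans ?_
    exact mul_le_mul_of_nonneg_left (by linarith) hc
  · -- size at `z − e_μ`: FILE C at `x := (torusT μ).symm z`
    have hz' : Site.tdist ((torusT (PV 2 ℓ m K hd3 hL) 0 μ).symm z) x₀ ≤ ρ + 1 := (tdist_unshift_le_succ z x₀ μ).trans (by omega)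
    refine (hsize' μ ((torusT (PV 2 ℓ m K hd3 hL) 0 μ).symm z) hz').trans ?_
    refine mul_le_mul_of_nonneg_left ?_ hc
    exact_mod_cast tdist_unshift_le_succ z x₀ μ
  · -- longitudinal difference at `z`: the FORWARD row of FILE C at `x := (torusT μ).symm z`, `ν := μ`
    have hz' : Site.tdist ((torusT (PV 2 ℓ m K hd3 hL) 0 μ).symm z) x₀ ≤ ρ + 1 := (tdist_unshift_le_succ z x₀ μ).trans (by omega)
    have hrow := hdiff μ μ ((torusT (PV 2 ℓ m K hd3 hL) 0 μ).symm z) hz'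
    have e : torusT (PV 2 ℓ m K hd3 hL) 0 μ ((torusT (PV 2 ℓ m K hd3 hL) 0 μ).symm z) = z := Equiv.apply_symm_apply _ _
    rw [e] at hrow ⊢
    refine hrow.trans ?_
    have ht : (Site.tdist ((torusT (PV 2 ℓ m K hd3 hL) 0 μ).symm z) x₀ : ℝ) + 1 ≤ (Site.tdist z x₀ : ℝ) + 2 := by
      have := tdist_unshift_le_succ z x₀ μ
      have : (Site.tdist ((torusT (PV 2 ℓ m K hd3 hL) 0 μ).symm z) x₀ : ℝ) ≤ (Site.tdist z x₀ : ℝ) + 1 := by exact_mod_cast this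
      linarith
    have := mul_le_mul_of_nonneg_left ht (mul_nonneg (mul_nonneg (by norm_num : (0 : ℝ) ≤ 2) hτ₁) hτ₂)
    linarith

end Member

/-! ## v1.2 (ym-routeR-w4 g11, «CONE SIZES») — the sizes of the cone letters `A₁ = τ₂ + 2τ₁²`, `A₀ = τ₂ + 4τ₁²`, `A₂ = 2τ₁τ₂`

With `τ₁ = ηC′e^{ηC′}`, `τ₂ = η·τ₁`, `0 < η ≤ 1` and `0 ≤ C′ ≤ c`: `A₁ ≤ η²α`, `A₀ ≤ η²α`, `A₂ ≤ η³α` for the single constant `α := c·e^{c}·(1 + 4·c·e^{c})`; at the member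
(`η = ℓ_k⁻¹`, `C′ = c35·(L·L^{a′})·α₀ ≤ c35·a₅`) this is `A₁ℓ_k² ≤ α`, `A₀ℓ_k² ≤ α`, `A₂ℓ_k³ ≤ α` — the `hA₁ hA₀ hA₂` rows of ✓ `Prop7TransplantGen0Arithmetic.gen0_total_le`. -/

section Sizes

/-- ★★ **THE CONE-LETTER SIZES** (`τ₁ := ηC′e^{ηC′}`, `τ₂ := η(ηC′)e^{ηC′}`; `0 < η ≤ 1`, `0 ≤ C′ ≤ c`): the three letters `τ₂ + 2τ₁²`, `τ₂ + 4τ₁²`, `2τ₁τ₂` are non-negative and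
bounded by `η²·α`, `η²·α`, `η³·α` with `α := c·e^{c}·(1 + 4·c·e^{c})`. [cite: Balaban1985RegularSpaces, (1.33) p.82 (bookkeeping of the frame constants)] -/
theorem cone_letter_sizes {η C' c : ℝ} (hη0 : 0 < η) (hη1 : η ≤ 1) (hC0 : 0 ≤ C') (hC : C' ≤ c) :
    0 ≤ η * (η * C') * Real.exp (η * C') + 2 * (η * C' * Real.exp (η * C')) ^ 2 ∧
    0 ≤ η * (η * C') * Real.exp (η * C') + 4 * (η * C' * Real.exp (η * C')) ^ 2 ∧
    0 ≤ 2 * (η * C' * Real.exp (η * C')) * (η * (η * C') * Real.exp (η * C')) ∧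
    η * (η * C') * Real.exp (η * C') + 2 * (η * C' * Real.exp (η * C')) ^ 2 ≤ η ^ 2 * (c * Real.exp c * (1 + 4 * (c * Real.exp c))) ∧
    η * (η * C') * Real.exp (η * C') + 4 * (η * C' * Real.exp (η * C')) ^ 2 ≤ η ^ 2 * (c * Real.exp c * (1 + 4 * (c * Real.exp c))) ∧
    2 * (η * C' * Real.exp (η * C')) * (η * (η * C') * Real.exp (η * C')) ≤ η ^ 3 * (c * Real.exp c * (1 + 4 * (c * Real.exp c))) := by
  have hc0 : 0 ≤ c := hC0.trans hC
  set E := Real.exp (η * C') with hE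
  set x := c * Real.exp c with hx
  have hE0 : 0 < E := Real.exp_pos _
  have hx0 : 0 ≤ x := mul_nonneg hc0 (Real.exp_pos _).le
  -- `ηC′ ≤ C′ ≤ c`, so `e^{ηC′} ≤ e^{c}` and `τ₁ ≤ η·x`
  have hηC : η * C' ≤ c := (mul_le_of_le_one_left hC0 hη1).trans hC
  have hEc : E ≤ Real.exp c := Real.exp_le_exp.2 hηC
  have hτ : η * C' * E ≤ η * x := by
    rw [mul_assoc]
    exact mul_le_mul_of_nonneg_left (mul_le_mul hC hEc hE0.le hc0) hη0.le
  have hτ0 : 0 ≤ η * C' * E := by positivity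
  have hτsq : (η * C' * E) ^ 2 ≤ (η * x) ^ 2 := pow_le_pow_left₀ hτ0 hτ (2 : ℕ)
  have hτ₂ : η * (η * C') * E = η * (η * C' * E) := by ring
  have hη2 : 0 ≤ η ^ 2 := sq_nonneg _
  have hη3 : η ^ 3 ≤ η ^ 2 := by nlinarith
  refine ⟨by positivity, by positivity, by positivity, ?_, ?_, ?_⟩
  · rw [hτ₂]
    have h1 : η * (η * C' * E) ≤ η * (η * x) := mul_le_mul_of_nonneg_left hτ hη0.le
    nlinarith
  · rw [hτ₂]
    have h1 : η * (η * C' * E) ≤ η * (η * x) := mul_le_mul_of_nonneg_left hτ hη0.le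
    nlinarith
  · rw [hτ₂]
    have h1 : 2 * (η * C' * E) * (η * (η * C' * E)) = 2 * η * (η * C' * E) ^ 2 := by ring
    rw [h1]
    have h2 : 2 * η * (η * C' * E) ^ 2 ≤ 2 * η * (η * x) ^ 2 := mul_le_mul_of_nonneg_left hτsq (by positivity)
    have h3 : 2 * η * (η * x) ^ 2 = η ^ 3 * (2 * x ^ 2) := by ring
    have h4 : 2 * x ^ 2 ≤ x * (1 + 4 * x) := by nlinarith
    calc 2 * η * (η * C' * E) ^ 2 ≤ η ^ 3 * (2 * x ^ 2) := h2.trans h3.le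
      _ ≤ η ^ 3 * (x * (1 + 4 * x)) := mul_le_mul_of_nonneg_left h4 (by positivity)

variable {ℓ : ℕ}

/-- ★★ **THE CONE-LETTER SIZES AT THE MEMBER**: with `ℓ_k := L^{K−n}` (`L = ℓ + 1`), `η := ℓ_k⁻¹`, `C′ := c35·(L·L^{a′})·α₀` and `L·L^{a′}·α₀ ≤ a₅` (the letters of
`exists_coneFrame_rows_anchored_of_regPr` VERBATIM), the cone letters satisfy `A₁·ℓ_k² ≤ α`, `A₀·ℓ_k² ≤ α`, `A₂·ℓ_k³ ≤ α`, `0 ≤ A₀, A₁, A₂` for the single constant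
`α := (c35·a₅)·e^{c35·a₅}·(1 + 4·(c35·a₅)·e^{c35·a₅})` — the `hA₁ hA₀ hA₂` inputs of ✓ `Prop7TransplantGen0Arithmetic.gen0_total_le`. [cite: Balaban1985RegularSpaces, (1.33) p.82] -/
theorem cone_letter_sizes_member {c35 a₅ α₀ : ℝ} (hc35 : 0 < c35) (hα₀ : 0 < α₀) {K n a' : ℕ}
    (hMα : ((ℓ + 1 : ℕ) : ℝ) * (((ℓ + 1) ^ a' : ℕ) : ℝ) * α₀ ≤ a₅) :
    (((((ℓ + 1 : ℕ) : ℝ) ^ (K - n))⁻¹ * ((((ℓ + 1 : ℕ) : ℝ) ^ (K - n))⁻¹ * (c35 * (((ℓ + 1 : ℕ) : ℝ) * (((ℓ + 1) ^ a' : ℕ) : ℝ)) * α₀))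
        * Real.exp ((((ℓ + 1 : ℕ) : ℝ) ^ (K - n))⁻¹ * (c35 * (((ℓ + 1 : ℕ) : ℝ) * (((ℓ + 1) ^ a' : ℕ) : ℝ)) * α₀)) + 2 * ((((ℓ + 1 : ℕ) : ℝ) ^ (K - n))⁻¹ * (c35 * (((ℓ + 1 : ℕ) : ℝ) * (((ℓ + 1) ^ a' : ℕ) : ℝ)) * α₀)
        * Real.exp ((((ℓ + 1 : ℕ) : ℝ) ^ (K - n))⁻¹ * (c35 * (((ℓ + 1 : ℕ) : ℝ) * (((ℓ + 1) ^ a' : ℕ) : ℝ)) * α₀))) ^ 2) * ((((ℓ + 1 : ℕ) : ℝ) ^ (K - n)) ^ 2)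
      ≤ c35 * a₅ * Real.exp (c35 * a₅) * (1 + 4 * (c35 * a₅ * Real.exp (c35 * a₅)))) ∧
    (((((ℓ + 1 : ℕ) : ℝ) ^ (K - n))⁻¹ * ((((ℓ + 1 : ℕ) : ℝ) ^ (K - n))⁻¹ * (c35 * (((ℓ + 1 : ℕ) : ℝ) * (((ℓ + 1) ^ a' : ℕ) : ℝ)) * α₀))
        * Real.exp ((((ℓ + 1 : ℕ) : ℝ) ^ (K - n))⁻¹ * (c35 * (((ℓ + 1 : ℕ) : ℝ) * (((ℓ + 1) ^ a' : ℕ) : ℝ)) * α₀)) + 4 * ((((ℓ + 1 : ℕ) : ℝ) ^ (K - n))⁻¹ * (c35 * (((ℓ + 1 : ℕ) : ℝ) * (((ℓ + 1) ^ a' : ℕ) : ℝ)) * α₀)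
        * Real.exp ((((ℓ + 1 : ℕ) : ℝ) ^ (K - n))⁻¹ * (c35 * (((ℓ + 1 : ℕ) : ℝ) * (((ℓ + 1) ^ a' : ℕ) : ℝ)) * α₀))) ^ 2) * ((((ℓ + 1 : ℕ) : ℝ) ^ (K - n)) ^ 2)
      ≤ c35 * a₅ * Real.exp (c35 * a₅) * (1 + 4 * (c35 * a₅ * Real.exp (c35 * a₅)))) ∧
    ((2 * ((((ℓ + 1 : ℕ) : ℝ) ^ (K - n))⁻¹ * (c35 * (((ℓ + 1 : ℕ) : ℝ) * (((ℓ + 1) ^ a' : ℕ) : ℝ)) * α₀)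
        * Real.exp ((((ℓ + 1 : ℕ) : ℝ) ^ (K - n))⁻¹ * (c35 * (((ℓ + 1 : ℕ) : ℝ) * (((ℓ + 1) ^ a' : ℕ) : ℝ)) * α₀))) * ((((ℓ + 1 : ℕ) : ℝ) ^ (K - n))⁻¹ * ((((ℓ + 1 : ℕ) : ℝ) ^ (K - n))⁻¹ * (c35 * (((ℓ + 1 : ℕ) : ℝ) * (((ℓ + 1) ^ a' : ℕ) : ℝ)) * α₀))
        * Real.exp ((((ℓ + 1 : ℕ) : ℝ) ^ (K - n))⁻¹ * (c35 * (((ℓ + 1 : ℕ) : ℝ) * (((ℓ + 1) ^ a' : ℕ) : ℝ)) * α₀)))) * ((((ℓ + 1 : ℕ) : ℝ) ^ (K - n)) ^ 3)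
      ≤ c35 * a₅ * Real.exp (c35 * a₅) * (1 + 4 * (c35 * a₅ * Real.exp (c35 * a₅)))) ∧
    0 ≤ (((ℓ + 1 : ℕ) : ℝ) ^ (K - n))⁻¹ * ((((ℓ + 1 : ℕ) : ℝ) ^ (K - n))⁻¹ * (c35 * (((ℓ + 1 : ℕ) : ℝ) * (((ℓ + 1) ^ a' : ℕ) : ℝ)) * α₀))
        * Real.exp ((((ℓ + 1 : ℕ) : ℝ) ^ (K - n))⁻¹ * (c35 * (((ℓ + 1 : ℕ) : ℝ) * (((ℓ + 1) ^ a' : ℕ) : ℝ)) * α₀)) + 4 * ((((ℓ + 1 : ℕ) : ℝ) ^ (K - n))⁻¹ * (c35 * (((ℓ + 1 : ℕ) : ℝ) * (((ℓ + 1) ^ a' : ℕ) : ℝ)) * α₀)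
        * Real.exp ((((ℓ + 1 : ℕ) : ℝ) ^ (K - n))⁻¹ * (c35 * (((ℓ + 1 : ℕ) : ℝ) * (((ℓ + 1) ^ a' : ℕ) : ℝ)) * α₀))) ^ 2 ∧
    0 ≤ (((ℓ + 1 : ℕ) : ℝ) ^ (K - n))⁻¹ * ((((ℓ + 1 : ℕ) : ℝ) ^ (K - n))⁻¹ * (c35 * (((ℓ + 1 : ℕ) : ℝ) * (((ℓ + 1) ^ a' : ℕ) : ℝ)) * α₀))
        * Real.exp ((((ℓ + 1 : ℕ) : ℝ) ^ (K - n))⁻¹ * (c35 * (((ℓ + 1 : ℕ) : ℝ) * (((ℓ + 1) ^ a' : ℕ) : ℝ)) * α₀)) + 2 * ((((ℓ + 1 : ℕ) : ℝ) ^ (K - n))⁻¹ * (c35 * (((ℓ + 1 : ℕ) : ℝ) * (((ℓ + 1) ^ a' : ℕ) : ℝ)) * α₀)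
        * Real.exp ((((ℓ + 1 : ℕ) : ℝ) ^ (K - n))⁻¹ * (c35 * (((ℓ + 1 : ℕ) : ℝ) * (((ℓ + 1) ^ a' : ℕ) : ℝ)) * α₀))) ^ 2 ∧
    0 ≤ 2 * ((((ℓ + 1 : ℕ) : ℝ) ^ (K - n))⁻¹ * (c35 * (((ℓ + 1 : ℕ) : ℝ) * (((ℓ + 1) ^ a' : ℕ) : ℝ)) * α₀)
        * Real.exp ((((ℓ + 1 : ℕ) : ℝ) ^ (K - n))⁻¹ * (c35 * (((ℓ + 1 : ℕ) : ℝ) * (((ℓ + 1) ^ a' : ℕ) : ℝ)) * α₀))) * ((((ℓ + 1 : ℕ) : ℝ) ^ (K - n))⁻¹ * ((((ℓ + 1 : ℕ) : ℝ) ^ (K - n))⁻¹ * (c35 * (((ℓ + 1 : ℕ) : ℝ) * (((ℓ + 1) ^ a' : ℕ) : ℝ)) * α₀))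
        * Real.exp ((((ℓ + 1 : ℕ) : ℝ) ^ (K - n))⁻¹ * (c35 * (((ℓ + 1 : ℕ) : ℝ) * (((ℓ + 1) ^ a' : ℕ) : ℝ)) * α₀))) := by
  set ℓk : ℝ := ((ℓ + 1 : ℕ) : ℝ) ^ (K - n) with hℓk
  set C' : ℝ := c35 * (((ℓ + 1 : ℕ) : ℝ) * (((ℓ + 1) ^ a' : ℕ) : ℝ)) * α₀ with hC'
  have hL1 : (1 : ℝ) ≤ ((ℓ + 1 : ℕ) : ℝ) := by exact_mod_cast Nat.succ_le_succ (Nat.zero_le ℓ)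
  have hℓk1 : 1 ≤ ℓk := one_le_pow₀ hL1
  have hℓk0 : 0 < ℓk := lt_of_lt_of_le one_pos hℓk1
  have hη0 : 0 < ℓk⁻¹ := inv_pos.2 hℓk0
  have hη1 : ℓk⁻¹ ≤ 1 := inv_le_one_of_one_le₀ hℓk1
  have hC0 : 0 ≤ C' := by rw [hC']; positivity
  have hC : C' ≤ c35 * a₅ := by
    rw [hC', mul_assoc]
    exact mul_le_mul_of_nonneg_left hMα hc35.le
  obtain ⟨h0₁, h0₀, h0₂, hA₁, hA₀, hA₂⟩ := cone_letter_sizes (c := c35 * a₅) hη0 hη1 hC0 hC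
  have hηℓ2 : ℓk⁻¹ ^ 2 * ℓk ^ 2 = 1 := by rw [← mul_pow, inv_mul_cancel₀ hℓk0.ne', one_pow]
  have hηℓ3 : ℓk⁻¹ ^ 3 * ℓk ^ 3 = 1 := by rw [← mul_pow, inv_mul_cancel₀ hℓk0.ne', one_pow]
  set αc : ℝ := c35 * a₅ * Real.exp (c35 * a₅) * (1 + 4 * (c35 * a₅ * Real.exp (c35 * a₅))) with hαc
  refine ⟨?_, ?_, ?_, h0₀, h0₁, h0₂⟩
  · have := mul_le_mul_of_nonneg_right hA₁ (pow_nonneg hℓk0.le 2)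
    calc _ ≤ ℓk⁻¹ ^ 2 * αc * ℓk ^ 2 := this
      _ = αc := by rw [mul_comm (ℓk⁻¹ ^ 2) αc, mul_assoc, hηℓ2, mul_one]
  · have := mul_le_mul_of_nonneg_right hA₀ (pow_nonneg hℓk0.le 2)
    calc _ ≤ ℓk⁻¹ ^ 2 * αc * ℓk ^ 2 := this
      _ = αc := by rw [mul_comm (ℓk⁻¹ ^ 2) αc, mul_assoc, hηℓ2, mul_one]
  · have := mul_le_mul_of_nonneg_right hA₂ (pow_nonneg hℓk0.le 3)
    calc _ ≤ ℓk⁻¹ ^ 3 * αc * ℓk ^ 3 := this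
      _ = αc := by rw [mul_comm (ℓk⁻¹ ^ 3) αc, mul_assoc, hηℓ3, mul_one]

end Sizes

end Summit.QuantumFields.YangMills.Theorems.Prop7ConeRegaugeInst

end
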